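import Mathlib
import Summits.MatrixMultiplication.MatrixMultiplication.Theses.MatrixPointInterpolation
import Summits.MatrixMultiplication.MatrixMultiplication.Theorems.MatrixPointInterpolationPointCount
import Literature.Algebra.PolynomialIdentities.GenericMatricesGrowth

/-!
# Line `tight-window` for crux `FewPointMasquerades` (route MatrixPointInterpolation)

Strategist line (crux-strategist, 2026-08-17).  TRANSFER/STRENGTHEN lens at crux level:
remove the points.  A *fast masquerade* — a pair `A ∈ M_n(ℂ)²` generating `M_n` in degree `d`,
satisfying every two-letter identity of `M_k` of degree `≤ 2d`, at the generic `var(M_k)` speed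
`(2d)^(k²+1) ≤ n^(2+θ)` — has a window of dimension `genericWordDim k (2d) ≤ K_k (2d)^(k²+1)`
(polynomial growth of two generic `k × k` matrices, GK-dimension `k² + 1`: Procesi 1967,
Berele/Belov; KBKR 2015 Thm 11.3.6/11.3.13/§11.2.5), and the route's proved `PointCount`
(greedy kernel shrinking, `pointCount_proof`) turns the window bound into `N ≤ K_k n^(2+θ)` points.
With `θ = ε/2` and `n` large this is the few-point family.

Stubs (registered): `stub_fastMasquerades` (the open core: maximal-speed windowed simple images
of the generic matrix algebra; by the tree's anti-Riemann–Roch inequality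
`n² ≤ K₁ g d^(k²)` (LooseMasquerades) it needs `θ ≥ 2/k²`, i.e. `k ≍ √(2/θ)`; the corner/shift
pairs proving `LongMasquerade` have `d = 2n - 2` and are useless here — and provably `(n/k)³`-point,
see `Cruxes/FewPointMasquerades/Ideas/slot-rank.md`), `stub_genericGrowthUpper` (literature, L-sized:
`genericWordDim k D ≤ K D^(k²+1)`; follows from the vendored named fact
`GenericMatricesQuasiPolynomialGrowth` via `.upper_of_one_le`, or directly from Procesi's
diagonalisation count).  Composition `FewPointMasquerades_of` is sorry-free.
-/

set_option linter.dupNamespace false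

namespace Summit.MatrixMultiplication.MatrixMultiplication.Cruxes.FewPointMasquerades.TightWindow

open scoped BigOperators
open Literature.Algebra.PolynomialIdentities (genericWordDim genericWordDim_mono)
open Summit.MatrixMultiplication.MatrixMultiplication.Theses.MatrixPointInterpolation (FewPointMasquerades)

/-- **STUB 1 — FAST MASQUERADES** (hardest; the open core; speed form of the window line).
For every `θ > 0` there is a point size `k ≥ 1` such that for every `n₀` some pair `A ∈ M_n(ℂ)²`,
`n ≥ n₀`, generates `M_n` in a degree `d` with `(2d)^(k²+1) ≤ n^(2+θ)` while satisfying every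
two-letter identity of `M_k` of degree `≤ 2d` ("masquerading as `M_k` to degree `2d`").
Why plausibly true: masquerades of `M_k` by arbitrarily large simple algebras exist (`LongMasquerade`,
corner pair, `k = 5`, `d = 2n-2`); the statement asks for them at the generic `var(M_k)` speed
`d ≍ n^(2/k²)` (the tree's anti-Riemann–Roch `n² ≤ K₁ g d^(k²)`, LooseMasquerades, forces `θ ≥ 2/k²`,
so `k ≍ √(2/θ)`), i.e. for maximal-speed windowed simple images of the generic matrix algebra.
Why it might fail: a masquerade SPEED LIMIT `ℓ(A) ≥ n^c` with `c k² > 2` (none is known; every known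
masquerade is letter-counting with `ℓ ≥ n - 1`).  Size: XL (research). -/
theorem stub_fastMasquerades :
    ∀ θ : ℝ, 0 < θ → ∃ k : ℕ, 1 ≤ k ∧ ∀ n₀ : ℕ, ∃ (n d : ℕ) (A : Fin 2 → Matrix (Fin n) (Fin n) ℂ),
      n₀ ≤ n ∧
      Submodule.span ℂ {M : Matrix (Fin n) (Fin n) ℂ |
        ∃ w : List (Fin 2), w.length ≤ d ∧ (w.map A).prod = M} = ⊤ ∧
      (∀ (T : Finset (List (Fin 2))) (c : List (Fin 2) → ℂ), (∀ w ∈ T, w.length ≤ 2 * d) →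
        (∀ B : Fin 2 → Matrix (Fin k) (Fin k) ℂ, (∑ w ∈ T, c w • (w.map B).prod) = 0) →
        (∑ w ∈ T, c w • (w.map A).prod) = 0) ∧
      (((2 * d : ℕ) : ℝ)) ^ (k ^ 2 + 1) ≤ (n : ℝ) ^ ((2 : ℝ) + θ) := by
  sorry

/-- **STUB 2 — GENERIC GROWTH, UPPER BOUND** (literature, L).  For every `k ≥ 1` there is `K > 0`
with `genericWordDim k D ≤ K · D^(k²+1)` for all `D ≥ 1`: the degree-`≤ D` words in two generic
`k × k` matrices span a space of polynomial growth with exponent the GK-dimension `k² + 1` of the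
generic matrix algebra (Procesi 1967; Kanel-Belov–Karasik–Rowen 2015 §11.2.5, p. 355 and Case 1
p. 367: `GKdim = (ℓ-1)n²+1`; a consequence of the tree's named fact
`Literature.Algebra.PolynomialIdentities.GenericMatricesQuasiPolynomialGrowth` via
`.upper_of_one_le` with `g = j`, or directly from Procesi's diagonalisation count). -/
theorem stub_genericGrowthUpper :
    ∀ k : ℕ, 1 ≤ k → ∃ K : ℝ, 0 < K ∧ ∀ D : ℕ, 1 ≤ D →
      (genericWordDim k D : ℝ) ≤ K * (D : ℝ) ^ (k ^ 2 + 1) := by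
  sorry

/-- The growth stub bounds every window, including the degenerate `D = 0`, by `K · max(D,1)^(k²+1)`. -/
theorem genericWordDim_le_of_upper {k : ℕ} {K : ℝ}
    (hK : ∀ D : ℕ, 1 ≤ D → (genericWordDim k D : ℝ) ≤ K * (D : ℝ) ^ (k ^ 2 + 1)) (D : ℕ) :
    (genericWordDim k D : ℝ) ≤ K * (max (D : ℝ) 1) ^ (k ^ 2 + 1) := by
  rcases Nat.eq_zero_or_pos D with rfl | hD
  · have h1 := hK 1 le_rfl
    have hmono : genericWordDim k 0 ≤ genericWordDim k 1 := genericWordDim_mono k (Nat.zero_le 1)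
    calc (genericWordDim k 0 : ℝ) ≤ genericWordDim k 1 := by exact_mod_cast hmono
      _ ≤ K * ((1 : ℕ) : ℝ) ^ (k ^ 2 + 1) := h1
      _ = K * (max ((0 : ℕ) : ℝ) 1) ^ (k ^ 2 + 1) := by simp
  · have hD1 : (1 : ℝ) ≤ (D : ℝ) := by exact_mod_cast hD
    rw [max_eq_left hD1]
    exact hK D hD

/-- **Composition** (sorry-free): stub 1 → stub 2 → the crux `FewPointMasquerades` BY NAME,
through the route's proved `PointCount` (`pointCount_proof`: `N ≤ genericWordDim k (2d)` points carry
the window `2d` of any masquerade) and real bookkeeping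
`N ≤ K · max(2d,1)^(k²+1) ≤ K · n^(2+ε/2) ≤ n^(2+ε)` (take `θ = ε/2`, `n ≥ ⌈K^(2/ε)⌉ + 1`). -/
theorem FewPointMasquerades_of
    (hFast : ∀ θ : ℝ, 0 < θ → ∃ k : ℕ, 1 ≤ k ∧ ∀ n₀ : ℕ,
      ∃ (n d : ℕ) (A : Fin 2 → Matrix (Fin n) (Fin n) ℂ),
      n₀ ≤ n ∧
      Submodule.span ℂ {M : Matrix (Fin n) (Fin n) ℂ |
        ∃ w : List (Fin 2), w.length ≤ d ∧ (w.map A).prod = M} = ⊤ ∧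
      (∀ (T : Finset (List (Fin 2))) (c : List (Fin 2) → ℂ), (∀ w ∈ T, w.length ≤ 2 * d) →
        (∀ B : Fin 2 → Matrix (Fin k) (Fin k) ℂ, (∑ w ∈ T, c w • (w.map B).prod) = 0) →
        (∑ w ∈ T, c w • (w.map A).prod) = 0) ∧
      (((2 * d : ℕ) : ℝ)) ^ (k ^ 2 + 1) ≤ (n : ℝ) ^ ((2 : ℝ) + θ))
    (hGrowth : ∀ k : ℕ, 1 ≤ k → ∃ K : ℝ, 0 < K ∧ ∀ D : ℕ, 1 ≤ D →
      (genericWordDim k D : ℝ) ≤ K * (D : ℝ) ^ (k ^ 2 + 1)) :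
    FewPointMasquerades := by
  intro ε hε
  -- accuracy θ = ε/2, point size k from the fast family, growth constant K for this k
  obtain ⟨k, hk1, hfam⟩ := hFast (ε / 2) (by linarith)
  obtain ⟨K, hK0, hK⟩ := hGrowth k hk1
  refine ⟨k, fun n₀ => ?_⟩
  -- threshold: n ≥ n₁ forces K ≤ n^(ε/2)
  set n₁ : ℕ := ⌈K ^ (ε / 2)⁻¹⌉₊ + 1 with hn₁
  obtain ⟨n, d, A, hn, hGen, hMasq, hSpeed⟩ := hfam (max n₀ n₁)
  have hn₀ : n₀ ≤ n := le_trans (le_max_left _ _) hn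
  have hnn₁ : n₁ ≤ n := le_trans (le_max_right _ _) hn
  have hn1 : (1 : ℝ) ≤ (n : ℝ) := by
    have : 1 ≤ n := le_trans (by omega) hnn₁
    exact_mod_cast this
  have hnpos : (0 : ℝ) < (n : ℝ) := by linarith
  -- the proved PointCount gives N ≤ genericWordDim k (2d) points carrying the window 2d
  obtain ⟨N, B, hN, hB⟩ :=
    Summit.MatrixMultiplication.MatrixMultiplication.Theorems.pointCount_proof n k d A hMasq
  refine ⟨n, d, N, A, B, hn₀, ?_, hGen, hB⟩
  -- real bookkeeping: N ≤ d̃_{2d} ≤ K · max(2d,1)^(k²+1) ≤ K · n^(2+ε/2) ≤ n^(2+ε)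
  have hNle : (N : ℝ) ≤ (genericWordDim k (2 * d) : ℝ) := by exact_mod_cast hN
  have hW : (genericWordDim k (2 * d) : ℝ) ≤ K * (max ((2 * d : ℕ) : ℝ) 1) ^ (k ^ 2 + 1) :=
    genericWordDim_le_of_upper hK (2 * d)
  have hpow1 : (1 : ℝ) ≤ (n : ℝ) ^ ((2 : ℝ) + ε / 2) :=
    Real.one_le_rpow hn1 (by linarith)
  have hmax : (max ((2 * d : ℕ) : ℝ) 1) ^ (k ^ 2 + 1) ≤ (n : ℝ) ^ ((2 : ℝ) + ε / 2) := by
    rcases le_total ((2 * d : ℕ) : ℝ) 1 with h | h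
    · rw [max_eq_right h, one_pow]; exact hpow1
    · rw [max_eq_left h]; exact hSpeed
  have hKn : K ≤ (n : ℝ) ^ (ε / 2) := by
    have hε2 : (0 : ℝ) < ε / 2 := by linarith
    have hKr : (0 : ℝ) ≤ K ^ (ε / 2)⁻¹ := Real.rpow_nonneg hK0.le _
    have hceil : K ^ (ε / 2)⁻¹ ≤ (n : ℝ) := by
      have h1 : K ^ (ε / 2)⁻¹ ≤ (⌈K ^ (ε / 2)⁻¹⌉₊ : ℝ) := Nat.le_ceil _
      have h2 : ((⌈K ^ (ε / 2)⁻¹⌉₊ : ℕ) : ℝ) ≤ (n : ℝ) := by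
        have : ⌈K ^ (ε / 2)⁻¹⌉₊ ≤ n := by omega
        exact_mod_cast this
      linarith
    calc K = (K ^ (ε / 2)⁻¹) ^ (ε / 2) := (Real.rpow_inv_rpow hK0.le hε2.ne').symm
      _ ≤ (n : ℝ) ^ (ε / 2) := Real.rpow_le_rpow hKr hceil hε2.le
  have hsplit : (n : ℝ) ^ ((2 : ℝ) + ε) = (n : ℝ) ^ (ε / 2) * (n : ℝ) ^ ((2 : ℝ) + ε / 2) := by
    rw [← Real.rpow_add hnpos]; congr 1; ring
  calc (N : ℝ) ≤ (genericWordDim k (2 * d) : ℝ) := hNle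
    _ ≤ K * (max ((2 * d : ℕ) : ℝ) 1) ^ (k ^ 2 + 1) := hW
    _ ≤ K * (n : ℝ) ^ ((2 : ℝ) + ε / 2) := mul_le_mul_of_nonneg_left hmax hK0.le
    _ ≤ (n : ℝ) ^ (ε / 2) * (n : ℝ) ^ ((2 : ℝ) + ε / 2) :=
        mul_le_mul_of_nonneg_right hKn (by positivity)
    _ = (n : ℝ) ^ ((2 : ℝ) + ε) := hsplit.symm

/-- The registered skeleton: the two stubs imply the crux by name. -/
theorem FewPointMasquerades_of_stubs : FewPointMasquerades :=
  FewPointMasquerades_of stub_fastMasquerades stub_genericGrowthUpper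

end Summit.MatrixMultiplication.MatrixMultiplication.Cruxes.FewPointMasquerades.TightWindow
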